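import Summits.CriticalPhenomena.PercolationContinuityZ3.Theorems.PercNearOneGluingNoHeavyRsw3LocalCountVariance
import HarnessLib

/-!
# RSW3 lane (P2, gen 23): THE DENSITY OF THE INFINITE CLUSTER, VI — second moment of a sum of `[0,1]`-valued observables with a bounded
# dependency neighbourhood (abstract probability; every measure)

builds on p205010 (kernel theorem, internal audit signed; external expert review pending) — NOT used in this file.

Cell `prim-rsw3`, prover seat `prim-rsw3-p2` (gen 23), memo `run/shared/lean/prim/rsw3/P2-RSWLITE.md` §30.
Support file (`--supports stmt-CriticalPhenomena-4575`); no definitions, no named facts, no sorries.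

Part I (`…Rsw3LocalCountVariance`) treated COUNTS of events.  The number of open clusters of a box is not a count of events but a
sum `Σ_x |C^{Λ}(x)|⁻¹` of `[0,1]`-valued local observables (part VII); this file is the corresponding engine.  For a probability
measure `μ`, a finite index set `S`, measurable `f_i : Ω → [0,1]` and neighbourhoods `near i` (`|near i| ≤ D`) such that
`E[f_i f_j] = E f_i · E f_j` whenever `j ∉ near i`:

* `integrable_mul_of_mem_Icc` — products of `[0,1]`-valued measurable functions are integrable;
* **`integral_sq_sum_sub_le`** — `E (Σ_{i∈S} f_i − Σ_{i∈S} E f_i)² ≤ |S|·D`;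
* **`real_le_abs_sum_sub_le`** — Chebyshev `μ(t ≤ |Σ f_i − Σ E f_i|) ≤ |S|D/t²`;
* **`integral_abs_sum_sub_le`** — `E|Σ f_i − Σ E f_i| ≤ a/2 + |S|D/(2a)` (`a > 0`).

References: as in part I (finite-range dependent sums; Chebyshev). [folklore]
-/

noncomputable section

namespace Summit.CriticalPhenomena.PercolationContinuityZ3.Theorems

namespace Rsw3

open MeasureTheory Finset

variable {Ω ι : Type*} [MeasurableSpace Ω]

/-- A measurable function with values in `[0,1]` is integrable for a finite measure, and so is its product with another one.
[folklore] -/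
theorem integrable_mul_of_mem_Icc (μ : Measure Ω) [IsFiniteMeasure μ] {f g : Ω → ℝ} (hf : Measurable f) (hg : Measurable g)
    (hf01 : ∀ ω, f ω ∈ Set.Icc (0 : ℝ) 1) (hg01 : ∀ ω, g ω ∈ Set.Icc (0 : ℝ) 1) :
    Integrable (fun ω => f ω * g ω) μ := by
  refine (integrable_const (1 : ℝ)).mono' (hf.mul hg).aestronglyMeasurable (Filter.Eventually.of_forall fun ω => ?_)
  rw [Real.norm_eq_abs, abs_of_nonneg (mul_nonneg (hf01 ω).1 (hg01 ω).1)]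
  calc f ω * g ω ≤ 1 * 1 := mul_le_mul (hf01 ω).2 (hg01 ω).2 (hg01 ω).1 zero_le_one
    _ = 1 := one_mul 1

/-- A measurable `[0,1]`-valued function is integrable for a finite measure. [folklore] -/
theorem integrable_of_mem_Icc (μ : Measure Ω) [IsFiniteMeasure μ] {f : Ω → ℝ} (hf : Measurable f)
    (hf01 : ∀ ω, f ω ∈ Set.Icc (0 : ℝ) 1) : Integrable f μ := by
  refine (integrable_const (1 : ℝ)).mono' hf.aestronglyMeasurable (Filter.Eventually.of_forall fun ω => ?_)
  rw [Real.norm_eq_abs, abs_of_nonneg (hf01 ω).1]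
  exact (hf01 ω).2

/-- **SECOND MOMENT OF A SUM OF `[0,1]`-VALUED OBSERVABLES WITH A BOUNDED DEPENDENCY NEIGHBOURHOOD**: `μ` a probability measure,
`f_i` (`i ∈ S`) measurable with values in `[0,1]`, `|near i| ≤ D`, and `E[f_i f_j] = E f_i E f_j` for `j ∉ near i`.  Then
`E (Σ_i f_i − Σ_i E f_i)² ≤ |S|·D` (`= Σ_{i,j} Cov(f_i,f_j)`; far covariances vanish, near ones are `≤ E[f_i f_j] ≤ 1`). [folklore] -/
theorem integral_sq_sum_sub_le (μ : Measure Ω) [IsProbabilityMeasure μ] (S : Finset ι) (f : ι → Ω → ℝ)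
    (hf : ∀ i ∈ S, Measurable (f i)) (hf01 : ∀ i ∈ S, ∀ ω, f i ω ∈ Set.Icc (0 : ℝ) 1)
    (near : ι → Finset ι) {D : ℕ} (hD : ∀ i ∈ S, (near i).card ≤ D)
    (hind : ∀ i ∈ S, ∀ j ∈ S, j ∉ near i → ∫ ω, f i ω * f j ω ∂μ = (∫ ω, f i ω ∂μ) * (∫ ω, f j ω ∂μ)) :
    ∫ ω, (∑ i ∈ S, f i ω - ∑ i ∈ S, ∫ ω', f i ω' ∂μ) ^ 2 ∂μ ≤ S.card * D := by
  classical
  set m : ι → ℝ := fun i => ∫ ω', f i ω' ∂μ with hm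
  -- centred variables
  set g : ι → Ω → ℝ := fun i ω => f i ω - m i with hg
  have hgm : ∀ i ∈ S, Measurable (g i) := fun i hi => (hf i hi).sub measurable_const
  have hm01 : ∀ i ∈ S, m i ∈ Set.Icc (0 : ℝ) 1 := fun i hi => by
    constructor
    · exact integral_nonneg fun ω => (hf01 i hi ω).1
    · calc m i ≤ ∫ _ω', (1 : ℝ) ∂μ :=
            integral_mono (integrable_of_mem_Icc μ (hf i hi) (hf01 i hi)) (integrable_const _) (fun ω => (hf01 i hi ω).2)
        _ = 1 := by simp
  have hgb : ∀ i ∈ S, ∀ ω, |g i ω| ≤ 1 := fun i hi ω => by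
    simp only [hg]
    rw [abs_le]
    constructor <;> linarith [(hf01 i hi ω).1, (hf01 i hi ω).2, (hm01 i hi).1, (hm01 i hi).2]
  have hIgg : ∀ i ∈ S, ∀ j ∈ S, Integrable (fun ω => g i ω * g j ω) μ := fun i hi j hj => by
    refine (integrable_const (1 : ℝ)).mono' ((hgm i hi).mul (hgm j hj)).aestronglyMeasurable
      (Filter.Eventually.of_forall fun ω => ?_)
    rw [Real.norm_eq_abs, abs_mul]
    calc |g i ω| * |g j ω| ≤ 1 * 1 := mul_le_mul (hgb i hi ω) (hgb j hj ω) (abs_nonneg _) zero_le_one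
      _ = 1 := one_mul 1
  -- `E[g_i g_j] = E[f_i f_j] − m_i m_j`
  have hcov : ∀ i ∈ S, ∀ j ∈ S, ∫ ω, g i ω * g j ω ∂μ = (∫ ω, f i ω * f j ω ∂μ) - m i * m j := by
    intro i hi j hj
    have hIff := integrable_mul_of_mem_Icc μ (hf i hi) (hf j hj) (hf01 i hi) (hf01 j hj)
    have hIf := integrable_of_mem_Icc μ (hf i hi) (hf01 i hi)
    have hIfj := integrable_of_mem_Icc μ (hf j hj) (hf01 j hj)
    have hpt : (fun ω => g i ω * g j ω) = fun ω => f i ω * f j ω - m j * f i ω - m i * f j ω + m i * m j := by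
      funext ω; simp only [hg]; ring
    have h1 : Integrable (fun ω => f i ω * f j ω - m j * f i ω) μ := hIff.sub (hIf.const_mul _)
    have h2 : Integrable (fun ω => f i ω * f j ω - m j * f i ω - m i * f j ω) μ := h1.sub (hIfj.const_mul _)
    rw [hpt, integral_add h2 (integrable_const _), integral_sub h1 (hIfj.const_mul _), integral_sub hIff (hIf.const_mul _),
      integral_const_mul, integral_const_mul, integral_const]
    simp only [probReal_univ, smul_eq_mul, one_mul, hm]
    ring
  -- expand the square
  have hsq : ∀ ω, (∑ i ∈ S, f i ω - ∑ i ∈ S, m i) ^ 2 = ∑ i ∈ S, ∑ j ∈ S, g i ω * g j ω := fun ω => by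
    rw [← Finset.sum_sub_distrib, sq, Finset.sum_mul_sum]
  simp_rw [hsq]
  rw [integral_finsetSum _ fun i hi => integrable_finsetSum _ fun j hj => hIgg i hi j hj]
  rw [Finset.sum_congr rfl fun i hi => integral_finsetSum _ fun j hj => hIgg i hi j hj]
  -- termwise bound
  have hrow : ∀ i ∈ S, ∑ j ∈ S, ∫ ω, g i ω * g j ω ∂μ ≤ D := by
    intro i hi
    calc ∑ j ∈ S, ∫ ω, g i ω * g j ω ∂μ ≤ ∑ j ∈ S, (if j ∈ near i then (1 : ℝ) else 0) := by
          refine Finset.sum_le_sum fun j hj => ?_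
          rw [hcov i hi j hj]
          split_ifs with hnear
          · have hle1 : ∀ ω, f i ω * f j ω ≤ 1 := fun ω => by
              calc f i ω * f j ω ≤ 1 * 1 := mul_le_mul (hf01 i hi ω).2 (hf01 j hj ω).2 (hf01 j hj ω).1 zero_le_one
                _ = 1 := one_mul 1
            have h1 : ∫ ω, f i ω * f j ω ∂μ ≤ 1 := by
              calc ∫ ω, f i ω * f j ω ∂μ ≤ ∫ _ω, (1 : ℝ) ∂μ :=
                    integral_mono (integrable_mul_of_mem_Icc μ (hf i hi) (hf j hj) (hf01 i hi) (hf01 j hj)) (integrable_const _) hle1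
                _ = 1 := by simp
            nlinarith [(hm01 i hi).1, (hm01 j hj).1]
          · rw [hind i hi j hj hnear]; simp [hm]
      _ = ((S.filter fun j => j ∈ near i).card : ℝ) := by
          rw [Finset.sum_ite, Finset.sum_const_zero, add_zero, Finset.sum_const, nsmul_eq_mul, mul_one]
      _ ≤ D := by
          have h1 : (S.filter fun j => j ∈ near i).card ≤ (near i).card :=
            Finset.card_le_card fun j hj => (Finset.mem_filter.1 hj).2
          exact_mod_cast h1.trans (hD i hi)
  calc ∑ i ∈ S, ∑ j ∈ S, ∫ ω, g i ω * g j ω ∂μ ≤ ∑ i ∈ S, (D : ℝ) := Finset.sum_le_sum hrow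
    _ = S.card * D := by rw [Finset.sum_const, nsmul_eq_mul]

/-- The centred sum is square integrable (bounded by `|S|`). [folklore] -/
theorem integrable_sq_sum_sub (μ : Measure Ω) [IsProbabilityMeasure μ] (S : Finset ι) (f : ι → Ω → ℝ)
    (hf : ∀ i ∈ S, Measurable (f i)) (hf01 : ∀ i ∈ S, ∀ ω, f i ω ∈ Set.Icc (0 : ℝ) 1) :
    Integrable (fun ω => (∑ i ∈ S, f i ω - ∑ i ∈ S, ∫ ω', f i ω' ∂μ) ^ 2) μ := by
  classical
  have hmeas : Measurable fun ω => ∑ i ∈ S, f i ω := Finset.measurable_sum _ fun i hi => hf i hi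
  refine (integrable_const (((S.card : ℝ) + S.card) ^ 2)).mono' ((hmeas.sub measurable_const).pow_const 2).aestronglyMeasurable
    (Filter.Eventually.of_forall fun ω => ?_)
  rw [Real.norm_eq_abs, abs_of_nonneg (sq_nonneg _), ← sq_abs]
  refine pow_le_pow_left₀ (abs_nonneg _) ?_ 2
  have h1 : |∑ i ∈ S, f i ω| ≤ S.card := by
    rw [abs_of_nonneg (Finset.sum_nonneg fun i hi => (hf01 i hi ω).1)]
    calc ∑ i ∈ S, f i ω ≤ ∑ i ∈ S, (1 : ℝ) := Finset.sum_le_sum fun i hi => (hf01 i hi ω).2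
      _ = S.card := by simp
  have h2 : |∑ i ∈ S, ∫ ω', f i ω' ∂μ| ≤ S.card := by
    have h01 : ∀ i ∈ S, (∫ ω', f i ω' ∂μ) ∈ Set.Icc (0 : ℝ) 1 := fun i hi => by
      constructor
      · exact integral_nonneg fun ω => (hf01 i hi ω).1
      · calc ∫ ω', f i ω' ∂μ ≤ ∫ _ω', (1 : ℝ) ∂μ :=
            integral_mono (integrable_of_mem_Icc μ (hf i hi) (hf01 i hi)) (integrable_const _) (fun ω => (hf01 i hi ω).2)
          _ = 1 := by simp
    rw [abs_of_nonneg (Finset.sum_nonneg fun i hi => (h01 i hi).1)]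
    calc ∑ i ∈ S, ∫ ω', f i ω' ∂μ ≤ ∑ i ∈ S, (1 : ℝ) := Finset.sum_le_sum fun i hi => (h01 i hi).2
      _ = S.card := by simp
  calc |∑ i ∈ S, f i ω - ∑ i ∈ S, ∫ ω', f i ω' ∂μ| ≤ |∑ i ∈ S, f i ω| + |∑ i ∈ S, ∫ ω', f i ω' ∂μ| := abs_sub _ _
    _ ≤ S.card + S.card := add_le_add h1 h2

/-- **Chebyshev**: under the hypotheses of `integral_sq_sum_sub_le`, `μ( t ≤ |Σ f_i − Σ E f_i| ) ≤ |S|·D/t²` (`t > 0`). [folklore] -/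
theorem real_le_abs_sum_sub_le (μ : Measure Ω) [IsProbabilityMeasure μ] (S : Finset ι) (f : ι → Ω → ℝ)
    (hf : ∀ i ∈ S, Measurable (f i)) (hf01 : ∀ i ∈ S, ∀ ω, f i ω ∈ Set.Icc (0 : ℝ) 1)
    (near : ι → Finset ι) {D : ℕ} (hD : ∀ i ∈ S, (near i).card ≤ D)
    (hind : ∀ i ∈ S, ∀ j ∈ S, j ∉ near i → ∫ ω, f i ω * f j ω ∂μ = (∫ ω, f i ω ∂μ) * (∫ ω, f j ω ∂μ))
    {t : ℝ} (ht : 0 < t) :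
    μ.real {ω | t ≤ |∑ i ∈ S, f i ω - ∑ i ∈ S, ∫ ω', f i ω' ∂μ|} ≤ S.card * D / t ^ 2 := by
  classical
  set X : Ω → ℝ := fun ω => ∑ i ∈ S, f i ω - ∑ i ∈ S, ∫ ω', f i ω' ∂μ with hX
  have hint : Integrable (fun ω => X ω ^ 2) μ := integrable_sq_sum_sub μ S f hf hf01
  have hmarkov := mul_meas_ge_le_integral_of_nonneg (μ := μ) (Filter.Eventually.of_forall fun ω => sq_nonneg (X ω)) hint (t ^ 2)
  have hle := integral_sq_sum_sub_le μ S f hf hf01 near hD hind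
  have hset : {ω | t ≤ |X ω|} = {ω | t ^ 2 ≤ X ω ^ 2} := by
    ext ω
    simp only [Set.mem_setOf_eq]
    constructor
    · intro h
      calc t ^ 2 ≤ |X ω| ^ 2 := pow_le_pow_left₀ ht.le h 2
        _ = X ω ^ 2 := sq_abs _
    · intro h
      have h' : t ^ 2 ≤ |X ω| ^ 2 := by rwa [sq_abs]
      exact (pow_le_pow_iff_left₀ ht.le (abs_nonneg _) two_ne_zero).1 h'
  have htpos : (0 : ℝ) < t ^ 2 := by positivity
  change μ.real {ω | t ≤ |X ω|} ≤ S.card * D / t ^ 2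
  rw [hset, le_div_iff₀ htpos, mul_comm]
  exact hmarkov.trans hle

/-- **`L¹` form**: under the hypotheses of `integral_sq_sum_sub_le`, `E|Σ f_i − Σ E f_i| ≤ a/2 + |S|·D/(2a)` for every `a > 0`.
[folklore] -/
theorem integral_abs_sum_sub_le (μ : Measure Ω) [IsProbabilityMeasure μ] (S : Finset ι) (f : ι → Ω → ℝ)
    (hf : ∀ i ∈ S, Measurable (f i)) (hf01 : ∀ i ∈ S, ∀ ω, f i ω ∈ Set.Icc (0 : ℝ) 1)
    (near : ι → Finset ι) {D : ℕ} (hD : ∀ i ∈ S, (near i).card ≤ D)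
    (hind : ∀ i ∈ S, ∀ j ∈ S, j ∉ near i → ∫ ω, f i ω * f j ω ∂μ = (∫ ω, f i ω ∂μ) * (∫ ω, f j ω ∂μ))
    {a : ℝ} (ha : 0 < a) :
    ∫ ω, |∑ i ∈ S, f i ω - ∑ i ∈ S, ∫ ω', f i ω' ∂μ| ∂μ ≤ a / 2 + S.card * D / (2 * a) := by
  classical
  set X : Ω → ℝ := fun ω => ∑ i ∈ S, f i ω - ∑ i ∈ S, ∫ ω', f i ω' ∂μ with hX
  have hint : Integrable (fun ω => X ω ^ 2) μ := integrable_sq_sum_sub μ S f hf hf01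
  have hle := integral_sq_sum_sub_le μ S f hf hf01 near hD hind
  have hbound : Integrable (fun ω => a / 2 + X ω ^ 2 / (2 * a)) μ := (integrable_const _).add (hint.div_const _)
  change ∫ ω, |X ω| ∂μ ≤ a / 2 + S.card * D / (2 * a)
  calc ∫ ω, |X ω| ∂μ ≤ ∫ ω, (a / 2 + X ω ^ 2 / (2 * a)) ∂μ :=
        integral_mono_of_nonneg (Filter.Eventually.of_forall fun ω => abs_nonneg _) hbound
          (Filter.Eventually.of_forall fun ω => Literature.Probability.Exchangeability.abs_le_half_add_sq_div ha)
    _ = a / 2 + (∫ ω, X ω ^ 2 ∂μ) / (2 * a) := by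
        rw [integral_add (integrable_const _) (hint.div_const _), integral_const, integral_div]
        simp
    _ ≤ a / 2 + S.card * D / (2 * a) := by
        have : (∫ ω, X ω ^ 2 ∂μ) / (2 * a) ≤ S.card * D / (2 * a) := div_le_div_of_nonneg_right hle (by positivity)
        linarith

end Rsw3

end Summit.CriticalPhenomena.PercolationContinuityZ3.Theorems
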